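import Summits.Ventures.Crystal3D.Theorems.StickyWulffConstantCoaxialWallLawRigidAll
import Summits.Ventures.Crystal3D.Theorems.StickyWulffConstantGenericWallFloorCapRigidity
import Summits.Ventures.Crystal3D.Theorems.StickyWulffConstantGenericWallFloorCredits
import HarnessLib

/-!
# `stub_coaxialTwoSlabAdhesion` for ARBITRARY fillings, modulo a defect charge

HONEST FRAMING. Part of the venture `Summits/Ventures/Crystal3D` (cell `crystal3d-full`), helper
`--supports` the crux `CoaxialWallLaw` (stmt-Ventures-19481, `route-Ventures-StickyWulffConstant`),
REGISTERED line `WallLedgerF` (planner cf-p1 gen 16), stub `stub_coaxialTwoSlabAdhesion`.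
RUNG CREDIT ONLY.  Rung F-C1 is not moved.

The rigid rung `coaxialTwoSlabAdhesion_rigid` (`…RigidAll`) proves the stub's inequality for fillings
`X ⊆ Λ₁ ∪ Λ₂`.  This file removes the rigidity premise at the price of an explicit residual: for an
ARBITRARY unit-separated filling `X` of the cell, with DEFECT SET `D = {x ∈ X | x ∉ Λ₁ ∪ Λ₂}`,

  `cross(P₁, X∖P₁) + cross(P₂, Y) ≤ D(Y) + (φ₁ + φ₂ − ½·s)·π·ρ² + C·(1+h)·ρ + Σ_{d ∈ D} (a_d + b_d/2 − 6)`

where `a_d = #{x ∈ X ∖ D | dist d x = 1} ≤ 6` (an off-lattice point has at most three unit contacts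
with each grain, `rung_offLatticeMoved`) and `b_d = #{d' ∈ D | dist d d' = 1}`, `a_d + b_d ≤ 12`
(kissing).  Hence the residual is at most `3·#D` (`coaxialTwoSlabAdhesion_modulo_defects`) and at most
`½·#{defect–defect contacts}` (isolated defects gain nothing).  Proof: apply the rigid rung to `X ∖ D`
(the sample layers lie on the grains, so `P₁, P₂ ⊆ X ∖ D` and their defining conditions are unchanged)
and book-keep the contacts through `D`.

WHAT THIS IS NOT: the stub (which has no residual); F-C1 not moved.  What the stub still needs is
exactly an argument that defect clusters (twin lamellae, …) do not gain at order `ρ²`.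
-/

noncomputable section

namespace Summit.Ventures.Crystal3D.Theorems

open Summit.Ventures.Crystal3D Finset
open Literature.MathematicalPhysics.StatisticalMechanics (barlowStacking fccStacking
  IsHaggSeq orderedContacts contactDeficiency)
open scoped InnerProductSpace

/-! ## Contact bookkeeping -/

/-- Contacts into a disjoint union (right factor). -/
theorem card_contacts_union_right (S T U : Finset (EuclideanSpace ℝ (Fin 3))) (hTU : Disjoint T U) :
    ((S ×ˢ (T ∪ U)).filter fun pq => dist pq.1 pq.2 = 1).card =
      ((S ×ˢ T).filter fun pq => dist pq.1 pq.2 = 1).card +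
        ((S ×ˢ U).filter fun pq => dist pq.1 pq.2 = 1).card := by
  classical
  rw [product_union, filter_union, card_union_of_disjoint]
  exact disjoint_filter_filter (disjoint_product.2 (Or.inr hTU))

/-- Contacts out of a disjoint union (left factor). -/
theorem card_contacts_union_left (S T U : Finset (EuclideanSpace ℝ (Fin 3))) (hST : Disjoint S T) :
    (((S ∪ T) ×ˢ U).filter fun pq => dist pq.1 pq.2 = 1).card =
      ((S ×ˢ U).filter fun pq => dist pq.1 pq.2 = 1).card +
        ((T ×ˢ U).filter fun pq => dist pq.1 pq.2 = 1).card := by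
  classical
  rw [union_product, filter_union, card_union_of_disjoint]
  exact disjoint_filter_filter (disjoint_product.2 (Or.inl hST))

/-- Contacts `S → D` counted from the `D` side. -/
theorem card_contacts_eq_sum_right (S D : Finset (EuclideanSpace ℝ (Fin 3))) :
    ((S ×ˢ D).filter fun pq => dist pq.1 pq.2 = 1).card =
      ∑ d ∈ D, (S.filter fun s => dist d s = 1).card := by
  classical
  rw [card_filter, sum_product_right]
  refine sum_congr rfl fun d _ => ?_
  rw [card_filter]
  refine sum_congr rfl fun s _ => ?_
  simp only [dist_comm d s]

/-- Contacts `D → S` counted from the `D` side. -/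
theorem card_contacts_eq_sum_left (D S : Finset (EuclideanSpace ℝ (Fin 3))) :
    ((D ×ˢ S).filter fun pq => dist pq.1 pq.2 = 1).card =
      ∑ d ∈ D, (S.filter fun s => dist d s = 1).card := by
  classical
  rw [card_filter, sum_product]
  refine sum_congr rfl fun d _ => ?_
  rw [card_filter]

/-- Neighbours in a disjoint union. -/
theorem card_nbrs_union (S T : Finset (EuclideanSpace ℝ (Fin 3))) (hST : Disjoint S T)
    (d : EuclideanSpace ℝ (Fin 3)) :
    ((S ∪ T).filter fun s => dist d s = 1).card =
      (S.filter fun s => dist d s = 1).card + (T.filter fun s => dist d s = 1).card := by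
  classical
  rw [filter_union, card_union_of_disjoint (disjoint_filter_filter hST)]

/-- The deficiency of a disjoint union `S ∪ D`. -/
theorem contactDeficiency_union (S D : Finset (EuclideanSpace ℝ (Fin 3))) (hSD : Disjoint S D) :
    contactDeficiency (S ∪ D) = contactDeficiency S + 6 * (D.card : ℝ) -
      ((((S ×ˢ D).filter fun pq => dist pq.1 pq.2 = 1).card : ℝ) +
        (((D ×ˢ S).filter fun pq => dist pq.1 pq.2 = 1).card : ℝ) +
        (((D ×ˢ D).filter fun pq => dist pq.1 pq.2 = 1).card : ℝ)) / 2 := by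
  classical
  rw [contactDeficiency, contactDeficiency, orderedContacts, orderedContacts,
    card_union_of_disjoint hSD, card_contacts_union_left S D _ hSD,
    card_contacts_union_right S S D hSD, card_contacts_union_right D S D hSD]
  push_cast
  ring

/-- **An off-lattice point touches at most six balls of `Λ₁ ∪ Λ₂`.** -/
theorem card_nbrs_onGrains_le_six
    (A₁ : EuclideanSpace ℝ (Fin 3) ≃ₗᵢ[ℝ] EuclideanSpace ℝ (Fin 3)) (t₁ : EuclideanSpace ℝ (Fin 3))
    (A₂ : EuclideanSpace ℝ (Fin 3) ≃ₗᵢ[ℝ] EuclideanSpace ℝ (Fin 3)) (t₂ : EuclideanSpace ℝ (Fin 3))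
    {d : EuclideanSpace ℝ (Fin 3)}
    (hd₁ : d ∉ (fun q => A₁ q + t₁) '' fccStacking 1 (Real.sqrt (2 / 3)))
    (hd₂ : d ∉ (fun q => A₂ q + t₂) '' fccStacking 1 (Real.sqrt (2 / 3)))
    (S : Finset (EuclideanSpace ℝ (Fin 3)))
    (hS : ∀ s ∈ S, s ∈ (fun q => A₁ q + t₁) '' fccStacking 1 (Real.sqrt (2 / 3)) ∨
      s ∈ (fun q => A₂ q + t₂) '' fccStacking 1 (Real.sqrt (2 / 3))) :
    (S.filter fun s => dist d s = 1).card ≤ 6 := by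
  classical
  set N := S.filter fun s => dist d s = 1 with hN
  set N₁ := N.filter fun s => s ∈ (fun q => A₁ q + t₁) '' fccStacking 1 (Real.sqrt (2 / 3)) with hN₁
  set N₂ := N.filter fun s => s ∉ (fun q => A₁ q + t₁) '' fccStacking 1 (Real.sqrt (2 / 3)) with hN₂
  have h₁ : N₁.card ≤ 3 := rung_offLatticeMoved A₁ t₁ d hd₁ N₁ fun s hs => by
    have hs' := mem_filter.1 hs
    exact ⟨hs'.2, (mem_filter.1 hs'.1).2⟩
  have h₂ : N₂.card ≤ 3 := rung_offLatticeMoved A₂ t₂ d hd₂ N₂ fun s hs => by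
    have hs' := mem_filter.1 hs
    have hsN := mem_filter.1 hs'.1
    exact ⟨(hS s hsN.1).resolve_left hs'.2, hsN.2⟩
  have hsplit : N.card = N₁.card + N₂.card := by
    rw [hN₁, hN₂, ← card_union_of_disjoint (disjoint_filter_filter_not N N _),
      filter_union_filter_not_eq]
  omega

/-! ## The stub modulo defects -/

/-- **`stub_coaxialTwoSlabAdhesion` for arbitrary fillings, modulo the defect charge.**  The stub's
hypotheses and conclusion verbatim, with the residual `3 · #D` added on the right for any finite
`D` off which the filling is rigid (`x ∈ X ∖ D ⇒ x ∈ Λ₁ ∪ Λ₂`); `R₀ = 3`. -/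
theorem coaxialTwoSlabAdhesion_modulo_defects
    (A₁ : EuclideanSpace ℝ (Fin 3) ≃ₗᵢ[ℝ] EuclideanSpace ℝ (Fin 3)) (t₁ : EuclideanSpace ℝ (Fin 3))
    (A₂ : EuclideanSpace ℝ (Fin 3) ≃ₗᵢ[ℝ] EuclideanSpace ℝ (Fin 3)) (t₂ : EuclideanSpace ℝ (Fin 3))
    (hcoax : ∃ (L : EuclideanSpace ℝ (Fin 3) ≃ₗᵢ[ℝ] EuclideanSpace ℝ (Fin 3))
        (s₁ s₂ : EuclideanSpace ℝ (Fin 3)) (σ σ' : ℤ → ℤ), IsHaggSeq σ ∧ IsHaggSeq σ' ∧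
        (fun p => A₁ p + t₁) '' fccStacking 1 (Real.sqrt (2 / 3)) ⊆
          (fun p => L p + s₁) '' barlowStacking 1 (Real.sqrt (2 / 3)) σ ∧
        (fun p => A₂ p + t₂) '' fccStacking 1 (Real.sqrt (2 / 3)) ⊆
          (fun p => L p + s₂) '' barlowStacking 1 (Real.sqrt (2 / 3)) σ')
    (hne : (fun p => A₁ p + t₁) '' fccStacking 1 (Real.sqrt (2 / 3)) ≠
      (fun p => A₂ p + t₂) '' fccStacking 1 (Real.sqrt (2 / 3))) :
    ∃ (L : EuclideanSpace ℝ (Fin 3) ≃ₗᵢ[ℝ] EuclideanSpace ℝ (Fin 3))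
        (s₁ s₂ : EuclideanSpace ℝ (Fin 3)) (σ σ' : ℤ → ℤ), IsHaggSeq σ ∧ IsHaggSeq σ' ∧
        (fun p => A₁ p + t₁) '' fccStacking 1 (Real.sqrt (2 / 3)) ⊆
          (fun p => L p + s₁) '' barlowStacking 1 (Real.sqrt (2 / 3)) σ ∧
        (fun p => A₂ p + t₂) '' fccStacking 1 (Real.sqrt (2 / 3)) ⊆
          (fun p => L p + s₂) '' barlowStacking 1 (Real.sqrt (2 / 3)) σ' ∧
    ∃ C R₀ : ℝ, 1 ≤ R₀ ∧ ∀ h : ℝ, 0 ≤ h → ∀ ρ : ℝ, R₀ ≤ ρ →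
      ∀ X P₁ P₂ : Finset (EuclideanSpace ℝ (Fin 3)),
      (∀ p ∈ X, ∀ q ∈ X, p ≠ q → 1 ≤ dist p q) → P₁ ⊆ X → P₂ ⊆ X \ P₁ →
      (∀ p ∈ X, -(2 * R₀) ≤ p 2 ∧ p 2 ≤ h + 2 * R₀ ∧ p 0 ^ 2 + p 1 ^ 2 ≤ ρ ^ 2) →
      (∀ p, p ∈ P₁ ↔ (p ∈ (fun q => A₁ q + t₁) '' fccStacking 1 (Real.sqrt (2 / 3)) ∧
        -(2 * R₀) ≤ p 2 ∧ p 2 ≤ -R₀ ∧ p 0 ^ 2 + p 1 ^ 2 ≤ ρ ^ 2)) →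
      (∀ p, p ∈ P₂ ↔ (p ∈ (fun q => A₂ q + t₂) '' fccStacking 1 (Real.sqrt (2 / 3)) ∧
        h + R₀ ≤ p 2 ∧ p 2 ≤ h + 2 * R₀ ∧ p 0 ^ 2 + p 1 ^ 2 ≤ ρ ^ 2)) →
      ∀ D : Finset (EuclideanSpace ℝ (Fin 3)),
      (∀ p ∈ X, p ∉ D → p ∈ (fun q => A₁ q + t₁) '' fccStacking 1 (Real.sqrt (2 / 3)) ∨
        p ∈ (fun q => A₂ q + t₂) '' fccStacking 1 (Real.sqrt (2 / 3))) →
      ((((P₁ ×ˢ (X \ P₁)).filter fun pq => dist pq.1 pq.2 = 1).card : ℕ) : ℝ) +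
        ((((P₂ ×ˢ ((X \ P₁) \ P₂)).filter fun pq => dist pq.1 pq.2 = 1).card : ℕ) : ℝ) ≤
        contactDeficiency ((X \ P₁) \ P₂) +
          (Real.sqrt 2 / 4 * ∑ᶠ w ∈ {w ∈ fccStacking 1 (Real.sqrt (2 / 3)) | ‖w‖ = 1},
              |⟪w, A₁.symm (EuclideanSpace.single (2 : Fin 3) (1 : ℝ))⟫_ℝ| +
            Real.sqrt 2 / 4 * ∑ᶠ w ∈ {w ∈ fccStacking 1 (Real.sqrt (2 / 3)) | ‖w‖ = 1},
              |⟪w, A₂.symm (EuclideanSpace.single (2 : Fin 3) (1 : ℝ))⟫_ℝ| -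
            (1 / 2 : ℝ) * Real.sqrt (1 - ⟪L (EuclideanSpace.single (2 : Fin 3) (1 : ℝ)),
              (EuclideanSpace.single (2 : Fin 3) (1 : ℝ))⟫_ℝ ^ 2)) * Real.pi * ρ ^ 2 +
          C * (1 + h) * ρ + 3 * (D.card : ℝ) := by
  classical
  obtain ⟨L, s₁, s₂, σ, σ', hσ, hσ', hsub₁, hsub₂, C, R₀, hR₀, hmain⟩ :=
    coaxialTwoSlabAdhesion_rigid A₁ t₁ A₂ t₂ hcoax hne
  refine ⟨L, s₁, s₂, σ, σ', hσ, hσ', hsub₁, hsub₂, C, R₀, hR₀, ?_⟩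
  intro h hh ρ hρ X P₁ P₂ hsep hP₁X hP₂X hcell hP₁ hP₂ D₁ hD₁
  set Λ₁ : Set (EuclideanSpace ℝ (Fin 3)) := (fun q => A₁ q + t₁) '' fccStacking 1 (Real.sqrt (2 / 3))
    with hΛ₁
  set Λ₂ : Set (EuclideanSpace ℝ (Fin 3)) := (fun q => A₂ q + t₂) '' fccStacking 1 (Real.sqrt (2 / 3))
    with hΛ₂
  set X' := X.filter fun p => p ∈ Λ₁ ∨ p ∈ Λ₂ with hX'
  set D := X.filter fun p => ¬ (p ∈ Λ₁ ∨ p ∈ Λ₂) with hD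
  have hXD : X' ∪ D = X := filter_union_filter_not_eq _ X
  have hdj : Disjoint X' D := disjoint_filter_filter_not X X _
  have hX'X : X' ⊆ X := filter_subset _ _
  have hDX : D ⊆ X := filter_subset _ _
  have hP₁X' : P₁ ⊆ X' := fun p hp => mem_filter.2 ⟨hP₁X hp, Or.inl ((hP₁ p).1 hp).1⟩
  have hP₂X' : P₂ ⊆ X' \ P₁ := fun p hp => by
    have hp' := mem_sdiff.1 (hP₂X hp)
    exact mem_sdiff.2 ⟨mem_filter.2 ⟨hp'.1, Or.inr ((hP₂ p).1 hp).1⟩, hp'.2⟩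
  -- the rigid rung for `X' = X ∖ D`
  have hrig := hmain h hh ρ hρ X' P₁ P₂ (fun p hp q hq => hsep p (hX'X hp) q (hX'X hq)) hP₁X' hP₂X'
    (fun p hp => hcell p (hX'X hp)) hP₁ hP₂ (fun p hp => (mem_filter.1 hp).2)
  -- decompositions `X ∖ P₁ = (X' ∖ P₁) ∪ D`, `Y = Y' ∪ D`
  have hDP₁ : Disjoint D P₁ := (hdj.mono_left hP₁X').symm
  have hDP₂ : Disjoint D P₂ := (hdj.mono_left (hP₂X'.trans sdiff_subset)).symm
  have e₁ : X \ P₁ = (X' \ P₁) ∪ D := by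
    rw [← hXD, union_sdiff_distrib, sdiff_eq_self_of_disjoint hDP₁]
  have e₂ : (X \ P₁) \ P₂ = ((X' \ P₁) \ P₂) ∪ D := by
    rw [e₁, union_sdiff_distrib, sdiff_eq_self_of_disjoint hDP₂]
  have hdj₁ : Disjoint (X' \ P₁) D := hdj.mono_left sdiff_subset
  have hdj₂ : Disjoint ((X' \ P₁) \ P₂) D := hdj.mono_left (sdiff_subset.trans sdiff_subset)
  set Y' := (X' \ P₁) \ P₂ with hY'
  -- per-defect bound
  have hper : ∀ d ∈ D,
      ((P₁.filter fun s => dist d s = 1).card : ℝ) + ((P₂.filter fun s => dist d s = 1).card : ℝ) +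
        ((Y'.filter fun s => dist d s = 1).card : ℝ) +
        ((D.filter fun s => dist d s = 1).card : ℝ) / 2 ≤ 9 := by
    intro d hd
    have hd' := (mem_filter.1 hd).2
    have hdΛ₁ : d ∉ Λ₁ := fun h' => hd' (Or.inl h')
    have hdΛ₂ : d ∉ Λ₂ := fun h' => hd' (Or.inr h')
    have ha : (X'.filter fun s => dist d s = 1).card ≤ 6 :=
      card_nbrs_onGrains_le_six A₁ t₁ A₂ t₂ hdΛ₁ hdΛ₂ X' fun s hs => (mem_filter.1 hs).2
    have hab : (X'.filter fun s => dist d s = 1).card + (D.filter fun s => dist d s = 1).card ≤ 12 := by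
      rw [← card_nbrs_union X' D hdj, hXD]
      exact card_filter_dist_eq_one_le_twelve X hsep d
    have hsplit : (X'.filter fun s => dist d s = 1).card =
        (P₁.filter fun s => dist d s = 1).card + ((P₂.filter fun s => dist d s = 1).card +
          (Y'.filter fun s => dist d s = 1).card) := by
      rw [← card_nbrs_union P₂ Y' disjoint_sdiff d, hY', union_sdiff_of_subset hP₂X',
        ← card_nbrs_union P₁ (X' \ P₁) disjoint_sdiff d, union_sdiff_of_subset hP₁X']
    have ha' : ((X'.filter fun s => dist d s = 1).card : ℝ) ≤ 6 := by exact_mod_cast ha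
    have hab' : ((X'.filter fun s => dist d s = 1).card : ℝ) +
        ((D.filter fun s => dist d s = 1).card : ℝ) ≤ 12 := by exact_mod_cast hab
    have hsplit' : ((X'.filter fun s => dist d s = 1).card : ℝ) =
        ((P₁.filter fun s => dist d s = 1).card : ℝ) + (((P₂.filter fun s => dist d s = 1).card : ℝ) +
          ((Y'.filter fun s => dist d s = 1).card : ℝ)) := by exact_mod_cast hsplit
    linarith
  have hsum := sum_le_sum hper
  simp only [sum_add_distrib, sum_const, nsmul_eq_mul, ← sum_div] at hsum
  -- contact identities
  have c₁ := card_contacts_eq_sum_right P₁ D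
  have c₂ := card_contacts_eq_sum_right P₂ D
  have c₃ := card_contacts_eq_sum_right Y' D
  have c₄ := card_contacts_eq_sum_left D Y'
  have c₅ := card_contacts_eq_sum_left D D
  have hcD := contactDeficiency_union Y' D hdj₂
  rw [e₂, e₁, card_contacts_union_right P₁ _ _ hdj₁, card_contacts_union_right P₂ _ _ hdj₂, hcD]
  rw [c₁, c₂, c₃, c₄, c₅]
  have hDD₁ : (D.card : ℝ) ≤ (D₁.card : ℝ) := by
    exact_mod_cast card_le_card fun p hp => by
      by_contra hpD₁
      exact (mem_filter.1 hp).2 (hD₁ p (mem_filter.1 hp).1 hpD₁)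
  push_cast at hrig hsum ⊢
  linarith

/-- **Isolated defects gain nothing.**  Same as `coaxialTwoSlabAdhesion_modulo_defects`, with the
residual `½ · #{(d, d') ∈ D × D | dist d d' = 1}` (ordered defect–defect contacts) instead of `3 · #D`:
per defect `d` the gain is `a_d + b_d/2 − 6 ≤ b_d/2` since `a_d ≤ 6`. -/
theorem coaxialTwoSlabAdhesion_modulo_defectContacts
    (A₁ : EuclideanSpace ℝ (Fin 3) ≃ₗᵢ[ℝ] EuclideanSpace ℝ (Fin 3)) (t₁ : EuclideanSpace ℝ (Fin 3))
    (A₂ : EuclideanSpace ℝ (Fin 3) ≃ₗᵢ[ℝ] EuclideanSpace ℝ (Fin 3)) (t₂ : EuclideanSpace ℝ (Fin 3))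
    (hcoax : ∃ (L : EuclideanSpace ℝ (Fin 3) ≃ₗᵢ[ℝ] EuclideanSpace ℝ (Fin 3))
        (s₁ s₂ : EuclideanSpace ℝ (Fin 3)) (σ σ' : ℤ → ℤ), IsHaggSeq σ ∧ IsHaggSeq σ' ∧
        (fun p => A₁ p + t₁) '' fccStacking 1 (Real.sqrt (2 / 3)) ⊆
          (fun p => L p + s₁) '' barlowStacking 1 (Real.sqrt (2 / 3)) σ ∧
        (fun p => A₂ p + t₂) '' fccStacking 1 (Real.sqrt (2 / 3)) ⊆
          (fun p => L p + s₂) '' barlowStacking 1 (Real.sqrt (2 / 3)) σ')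
    (hne : (fun p => A₁ p + t₁) '' fccStacking 1 (Real.sqrt (2 / 3)) ≠
      (fun p => A₂ p + t₂) '' fccStacking 1 (Real.sqrt (2 / 3))) :
    ∃ (L : EuclideanSpace ℝ (Fin 3) ≃ₗᵢ[ℝ] EuclideanSpace ℝ (Fin 3))
        (s₁ s₂ : EuclideanSpace ℝ (Fin 3)) (σ σ' : ℤ → ℤ), IsHaggSeq σ ∧ IsHaggSeq σ' ∧
        (fun p => A₁ p + t₁) '' fccStacking 1 (Real.sqrt (2 / 3)) ⊆
          (fun p => L p + s₁) '' barlowStacking 1 (Real.sqrt (2 / 3)) σ ∧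
        (fun p => A₂ p + t₂) '' fccStacking 1 (Real.sqrt (2 / 3)) ⊆
          (fun p => L p + s₂) '' barlowStacking 1 (Real.sqrt (2 / 3)) σ' ∧
    ∃ C R₀ : ℝ, 1 ≤ R₀ ∧ ∀ h : ℝ, 0 ≤ h → ∀ ρ : ℝ, R₀ ≤ ρ →
      ∀ X P₁ P₂ : Finset (EuclideanSpace ℝ (Fin 3)),
      (∀ p ∈ X, ∀ q ∈ X, p ≠ q → 1 ≤ dist p q) → P₁ ⊆ X → P₂ ⊆ X \ P₁ →
      (∀ p ∈ X, -(2 * R₀) ≤ p 2 ∧ p 2 ≤ h + 2 * R₀ ∧ p 0 ^ 2 + p 1 ^ 2 ≤ ρ ^ 2) →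
      (∀ p, p ∈ P₁ ↔ (p ∈ (fun q => A₁ q + t₁) '' fccStacking 1 (Real.sqrt (2 / 3)) ∧
        -(2 * R₀) ≤ p 2 ∧ p 2 ≤ -R₀ ∧ p 0 ^ 2 + p 1 ^ 2 ≤ ρ ^ 2)) →
      (∀ p, p ∈ P₂ ↔ (p ∈ (fun q => A₂ q + t₂) '' fccStacking 1 (Real.sqrt (2 / 3)) ∧
        h + R₀ ≤ p 2 ∧ p 2 ≤ h + 2 * R₀ ∧ p 0 ^ 2 + p 1 ^ 2 ≤ ρ ^ 2)) →
      ∀ D : Finset (EuclideanSpace ℝ (Fin 3)),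
      (∀ p ∈ X, p ∉ D → p ∈ (fun q => A₁ q + t₁) '' fccStacking 1 (Real.sqrt (2 / 3)) ∨
        p ∈ (fun q => A₂ q + t₂) '' fccStacking 1 (Real.sqrt (2 / 3))) →
      ((((P₁ ×ˢ (X \ P₁)).filter fun pq => dist pq.1 pq.2 = 1).card : ℕ) : ℝ) +
        ((((P₂ ×ˢ ((X \ P₁) \ P₂)).filter fun pq => dist pq.1 pq.2 = 1).card : ℕ) : ℝ) ≤
        contactDeficiency ((X \ P₁) \ P₂) +
          (Real.sqrt 2 / 4 * ∑ᶠ w ∈ {w ∈ fccStacking 1 (Real.sqrt (2 / 3)) | ‖w‖ = 1},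
              |⟪w, A₁.symm (EuclideanSpace.single (2 : Fin 3) (1 : ℝ))⟫_ℝ| +
            Real.sqrt 2 / 4 * ∑ᶠ w ∈ {w ∈ fccStacking 1 (Real.sqrt (2 / 3)) | ‖w‖ = 1},
              |⟪w, A₂.symm (EuclideanSpace.single (2 : Fin 3) (1 : ℝ))⟫_ℝ| -
            (1 / 2 : ℝ) * Real.sqrt (1 - ⟪L (EuclideanSpace.single (2 : Fin 3) (1 : ℝ)),
              (EuclideanSpace.single (2 : Fin 3) (1 : ℝ))⟫_ℝ ^ 2)) * Real.pi * ρ ^ 2 +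
          C * (1 + h) * ρ +
            (1 / 2 : ℝ) * ((((D ×ˢ D).filter fun pq => dist pq.1 pq.2 = 1).card : ℕ) : ℝ) := by
  classical
  obtain ⟨L, s₁, s₂, σ, σ', hσ, hσ', hsub₁, hsub₂, C, R₀, hR₀, hmain⟩ :=
    coaxialTwoSlabAdhesion_rigid A₁ t₁ A₂ t₂ hcoax hne
  refine ⟨L, s₁, s₂, σ, σ', hσ, hσ', hsub₁, hsub₂, C, R₀, hR₀, ?_⟩
  intro h hh ρ hρ X P₁ P₂ hsep hP₁X hP₂X hcell hP₁ hP₂ D₁ hD₁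
  set Λ₁ : Set (EuclideanSpace ℝ (Fin 3)) := (fun q => A₁ q + t₁) '' fccStacking 1 (Real.sqrt (2 / 3))
    with hΛ₁
  set Λ₂ : Set (EuclideanSpace ℝ (Fin 3)) := (fun q => A₂ q + t₂) '' fccStacking 1 (Real.sqrt (2 / 3))
    with hΛ₂
  set X' := X.filter fun p => p ∈ Λ₁ ∨ p ∈ Λ₂ with hX'
  set D := X.filter fun p => ¬ (p ∈ Λ₁ ∨ p ∈ Λ₂) with hD
  have hXD : X' ∪ D = X := filter_union_filter_not_eq _ X
  have hdj : Disjoint X' D := disjoint_filter_filter_not X X _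
  have hX'X : X' ⊆ X := filter_subset _ _
  have hDX : D ⊆ X := filter_subset _ _
  have hP₁X' : P₁ ⊆ X' := fun p hp => mem_filter.2 ⟨hP₁X hp, Or.inl ((hP₁ p).1 hp).1⟩
  have hP₂X' : P₂ ⊆ X' \ P₁ := fun p hp => by
    have hp' := mem_sdiff.1 (hP₂X hp)
    exact mem_sdiff.2 ⟨mem_filter.2 ⟨hp'.1, Or.inr ((hP₂ p).1 hp).1⟩, hp'.2⟩
  -- the rigid rung for `X' = X ∖ D`
  have hrig := hmain h hh ρ hρ X' P₁ P₂ (fun p hp q hq => hsep p (hX'X hp) q (hX'X hq)) hP₁X' hP₂X'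
    (fun p hp => hcell p (hX'X hp)) hP₁ hP₂ (fun p hp => (mem_filter.1 hp).2)
  -- decompositions `X ∖ P₁ = (X' ∖ P₁) ∪ D`, `Y = Y' ∪ D`
  have hDP₁ : Disjoint D P₁ := (hdj.mono_left hP₁X').symm
  have hDP₂ : Disjoint D P₂ := (hdj.mono_left (hP₂X'.trans sdiff_subset)).symm
  have e₁ : X \ P₁ = (X' \ P₁) ∪ D := by
    rw [← hXD, union_sdiff_distrib, sdiff_eq_self_of_disjoint hDP₁]
  have e₂ : (X \ P₁) \ P₂ = ((X' \ P₁) \ P₂) ∪ D := by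
    rw [e₁, union_sdiff_distrib, sdiff_eq_self_of_disjoint hDP₂]
  have hdj₁ : Disjoint (X' \ P₁) D := hdj.mono_left sdiff_subset
  have hdj₂ : Disjoint ((X' \ P₁) \ P₂) D := hdj.mono_left (sdiff_subset.trans sdiff_subset)
  set Y' := (X' \ P₁) \ P₂ with hY'
  -- per-defect bound
  have hper : ∀ d ∈ D,
      ((P₁.filter fun s => dist d s = 1).card : ℝ) + ((P₂.filter fun s => dist d s = 1).card : ℝ) +
        ((Y'.filter fun s => dist d s = 1).card : ℝ) ≤ 6 := by
    intro d hd
    have hd' := (mem_filter.1 hd).2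
    have hdΛ₁ : d ∉ Λ₁ := fun h' => hd' (Or.inl h')
    have hdΛ₂ : d ∉ Λ₂ := fun h' => hd' (Or.inr h')
    have ha : (X'.filter fun s => dist d s = 1).card ≤ 6 :=
      card_nbrs_onGrains_le_six A₁ t₁ A₂ t₂ hdΛ₁ hdΛ₂ X' fun s hs => (mem_filter.1 hs).2
    have hsplit : (X'.filter fun s => dist d s = 1).card =
        (P₁.filter fun s => dist d s = 1).card + ((P₂.filter fun s => dist d s = 1).card +
          (Y'.filter fun s => dist d s = 1).card) := by
      rw [← card_nbrs_union P₂ Y' disjoint_sdiff d, hY', union_sdiff_of_subset hP₂X',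
        ← card_nbrs_union P₁ (X' \ P₁) disjoint_sdiff d, union_sdiff_of_subset hP₁X']
    have ha' : ((X'.filter fun s => dist d s = 1).card : ℝ) ≤ 6 := by exact_mod_cast ha
    have hsplit' : ((X'.filter fun s => dist d s = 1).card : ℝ) =
        ((P₁.filter fun s => dist d s = 1).card : ℝ) + (((P₂.filter fun s => dist d s = 1).card : ℝ) +
          ((Y'.filter fun s => dist d s = 1).card : ℝ)) := by exact_mod_cast hsplit
    linarith
  have hsum := sum_le_sum hper
  simp only [sum_add_distrib, sum_const, nsmul_eq_mul] at hsum
  -- contact identities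
  have c₁ := card_contacts_eq_sum_right P₁ D
  have c₂ := card_contacts_eq_sum_right P₂ D
  have c₃ := card_contacts_eq_sum_right Y' D
  have c₄ := card_contacts_eq_sum_left D Y'
  have c₅ := card_contacts_eq_sum_left D D
  have hcD := contactDeficiency_union Y' D hdj₂
  rw [e₂, e₁, card_contacts_union_right P₁ _ _ hdj₁, card_contacts_union_right P₂ _ _ hdj₂, hcD]
  rw [c₁, c₂, c₃, c₄, c₅]
  have hDD₁ : D ⊆ D₁ := fun p hp => by
    by_contra hpD₁
    exact (mem_filter.1 hp).2 (hD₁ p (mem_filter.1 hp).1 hpD₁)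
  have hcc : ((((D ×ˢ D).filter fun pq => dist pq.1 pq.2 = 1).card : ℕ) : ℝ) ≤
      ((((D₁ ×ˢ D₁).filter fun pq => dist pq.1 pq.2 = 1).card : ℕ) : ℝ) := by
    exact_mod_cast card_le_card (filter_subset_filter _ (product_subset_product hDD₁ hDD₁))
  rw [c₅] at hcc
  push_cast at hrig hsum hcc ⊢
  linarith

end Summit.Ventures.Crystal3D.Theorems

end
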